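import Summits.HubbardSuperconductivity.HubbardSuperconductivity.Theorems.BirComplexStableXY.Negative.WitnessTable
import HarnessLib

/-!
# Crux `BirComplexStableXYR`, line `fat-gaussian-defect-calculus`: stub H2 `stub_genF_complexShift_le`

Registered stub (lead c8, wave 10, skeleton `Cruxes/BirComplexStableXYR/Lines/fat_gaussian_defect_calculus.lean`),
helper (`--supports`) for the crux `Summit.HubbardSuperconductivity.HubbardSuperconductivity.Theses.BalabanIR.BirComplexStableXYR`:
**the analyticity strip of hypothesis (A).**

**Statement.** For a finite Fourier table `c : Table r` on the window `W r = Fin r × Fin r × Fin r` (vocabulary of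
`Theorems.BirComplexStableXY.Negative.WitnessTable`) and real window configurations `u v : W r → ℝ` with `|v w| ≤ 1`
for every `w`, the complex-shifted window weight `Σ_n c_n exp(i n·u − n·v)` has modulus at most
`normA c = Σ_n ‖c_n‖ e^{Σ_w |n_w|}`.

**Proof.** Both sides are finite sums over `supp c` (`Finsupp.sum`).  By `norm_sum_le` it suffices to compare the
terms: `‖c_n exp(i n·u − n·v)‖ = ‖c_n‖ e^{Re(i n·u − n·v)} = ‖c_n‖ e^{−n·v}` (`Complex.norm_exp`; the purely
imaginary part `i n·u` has real part `0`), and `−n·v ≤ |Σ_w n_w v_w| ≤ Σ_w |n_w| |v_w| ≤ Σ_w |n_w|` because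
`|v_w| ≤ 1` (`neg_le_abs`, `Finset.abs_sum_le_sum_abs`, `abs_mul`, `mul_le_of_le_one_right`); conclude with the
monotonicity of `exp` (`Real.exp_le_exp`).  Elementary; no definition and no named fact is introduced; sorry-free.
[folklore]
-/

set_option linter.dupNamespace false -- `Summit.<S>.<S>.Theorems…` repeats the summit name (D-0017 layout)

namespace Summit.HubbardSuperconductivity.HubbardSuperconductivity.Theorems.FSUnfolding

open scoped BigOperators ComplexConjugate
open Literature.Probability.LatticeModels
open Summit.HubbardSuperconductivity.BirComplexStableXYNegative

/-- The real part of `I * x - y` for real `x, y` is `-y`. [folklore] -/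
theorem hsc_re_I_mul_ofReal_sub_ofReal (x y : ℝ) : (Complex.I * (x : ℂ) - (y : ℂ)).re = -y := by
  simp [Complex.sub_re, Complex.mul_re, Complex.I_re, Complex.I_im, Complex.ofReal_re, Complex.ofReal_im]

/-- On the strip `‖v‖_∞ ≤ 1`: `-(Σ_i n_i v_i) ≤ Σ_i |n_i|`. [folklore] -/
theorem hsc_neg_dot_le_sum_abs {ι : Type*} [Fintype ι] (n v : ι → ℝ) (hv : ∀ i, |v i| ≤ 1) :
    -(∑ i, n i * v i) ≤ ∑ i, |n i| := by
  calc -(∑ i, n i * v i) ≤ |∑ i, n i * v i| := neg_le_abs _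
    _ ≤ ∑ i, |n i * v i| := Finset.abs_sum_le_sum_abs _ _
    _ ≤ ∑ i, |n i| := Finset.sum_le_sum fun i _ => by
        rw [abs_mul]
        exact mul_le_of_le_one_right (abs_nonneg _) (hv i)

/-- Termwise strip bound: `‖a · exp(i n·u − n·v)‖ ≤ ‖a‖ e^{Σ_w |n_w|}` when `|v_w| ≤ 1` for all `w`. [folklore] -/
theorem hsc_norm_complexShift_term_le {r : ℕ} (n : Freq r) (a : ℂ) (u v : W r → ℝ)
    (hv : ∀ w : W r, |v w| ≤ 1) :
    ‖a * Complex.exp (Complex.I * ((∑ w, (n w : ℝ) * u w : ℝ) : ℂ) - ((∑ w, (n w : ℝ) * v w : ℝ) : ℂ))‖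
      ≤ ‖a‖ * Real.exp (∑ w, |(n w : ℝ)|) := by
  rw [norm_mul, Complex.norm_exp, hsc_re_I_mul_ofReal_sub_ofReal]
  exact mul_le_mul_of_nonneg_left
    (Real.exp_le_exp.mpr (hsc_neg_dot_le_sum_abs (fun w => (n w : ℝ)) v hv)) (norm_nonneg _)

/-- **Registered stub H2 `stub_genF_complexShift_le` (verbatim signature): the analyticity strip of hypothesis (A).**
The window weight extends to complex window configurations `u + iv`, `genF c (u + iv) = Σ_n c_n e^{i n·u − n·v}`, and
on the strip `‖v‖_∞ ≤ 1` its modulus is at most `Σ_n ‖c_n‖ e^{|n|₁} = normA c` (termwise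
`|e^{i n·u − n·v}| = e^{−n·v} ≤ e^{|n|₁ ‖v‖_∞} ≤ e^{|n|₁}`). [folklore] -/
theorem stub_genF_complexShift_le :
    ∀ (r : ℕ) (c : Table r) (u v : W r → ℝ), (∀ w : W r, |v w| ≤ 1) →
      ‖c.sum (fun n a => a * Complex.exp (Complex.I * ((∑ w, (n w : ℝ) * u w : ℝ) : ℂ)
          - ((∑ w, (n w : ℝ) * v w : ℝ) : ℂ)))‖ ≤ normA c := by
  intro r c u v hv
  unfold normA Finsupp.sum
  exact (norm_sum_le _ _).trans
    (Finset.sum_le_sum fun n _ => hsc_norm_complexShift_term_le n (c n) u v hv)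

end Summit.HubbardSuperconductivity.HubbardSuperconductivity.Theorems.FSUnfolding
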